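import Mathlib
import Summits.QuantumFields.YangMills.Theorems.ConvexGribovBodyContinuumLegGivenGapStubCsclLattice
import Summits.QuantumFields.YangMills.Theorems.ParabolicTrajectoryContinuumLimitOnTrajectoryUclSums
import HarnessLib

/-!
# `ContinuumLegGivenGap` (stmt-QuantumFields-15828), line `Sketch`, reshape 18b: helpers for `stub_csclKLevel` (part A)

Support file for the crux item stmt-QuantumFields-15828 (registered glue stub `stub_csclKLevel` of line `Sketch`, reshape 18b;
registered anchor of this file: `cscl_anchor_klevelA`). Elementary estimates used by the k-level uniform Cauchy–Schwarz clustering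
theorem: the torus mean of a bounded observable is bounded (`klevel_abs_mean_le`); sup norm of a weighted representative
(`klevel_rep_norm_le`); raw monomial pairings are bounded (`klevel_raw_bound`); the far part of the Schwartz coefficient sum over
box-`L` strings is controlled by the lattice-weight tail (`klevel_far_sum_le`, from `norm_apply_le_schwartzNorm_mul` and the shape of
`stub_csclLattice`.1); `√(x + y) ≤ √x + √y`; and the arithmetic endgame `klevel_endgame`. No definitions, no facts; Mathlib + landed tree
lemmas only. [folklore]
-/

noncomputable section

namespace Summit.QuantumFields.YangMills.Theorems.ContinuumLegGivenGap

open scoped SchwartzMap ComplexConjugate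
open Filter Topology MeasureTheory
open Literature.MathematicalPhysics.QuantumFieldTheory Literature.MathematicalPhysics.QuantumLattice
  Literature.MathematicalPhysics.AQFT Literature.Probability.LatticeModels
open Summit.QuantumFields.YangMills.Cruxes.ContinuumLimitOnTrajectory.TwoOrbitSynchronisation
  (norm_apply_le_schwartzNorm_mul sum_norm_apply_smul_siteToE_le)

section Helpers

variable {G : Type} [Group G] [TopologicalSpace G] [IsTopologicalGroup G] [CompactSpace G]
  [MeasurableSpace G] [BorelSpace G]

/-- The torus Wilson mean of an observable bounded by `MP` is bounded by `MP`. [folklore] -/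
theorem klevel_abs_mean_le (r : LatticeRep G) (β : ℝ) (L : ℕ) {P : LGConfig 4 G → ℝ} {MP : ℝ}
    (hP : ∀ U, |P U| ≤ MP) : |wilsonTorusMean r.ρ β L P| ≤ MP := by
  haveI := isProbabilityMeasure_wilsonMeasure (d := 4) (L := 2 * L + 1) r.ρ r.continuous β
  unfold wilsonTorusMean
  have h := norm_integral_le_of_norm_le_const (μ := wilsonMeasure (d := 4) (L := 2 * L + 1) r.ρ β)
    (f := fun U : GaugeConfig 4 (2 * L + 1) G => P (torusLift (2 * L + 1) U)) (C := MP)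
    (Eventually.of_forall fun U => by rw [Real.norm_eq_abs]; exact hP _)
  simpa [Real.norm_eq_abs] using h

/-- **Sup norm of a weighted representative**: `‖∑ₓ w(x) ∏ᵢ (P(τ_{xᵢ}V) − mc)‖ ≤ (∑ₓ ‖w x‖) (MP + |mc|)ⁿ`. [folklore] -/
theorem klevel_rep_norm_le (r : LatticeRep G) {n R : ℕ} (w : (Fin n → ↥(box 4 R)) → ℂ) (mc : ℝ) {MP : ℝ}
    (hP : ∀ U, |r.curvature.F U| ≤ MP) (V : LGConfig 4 G) :
    ‖∑ x : Fin n → ↥(box 4 R), w x * ∏ i, ((r.curvature.F (configShift (-(↑(x i) : Site 4)) V) - mc : ℝ) : ℂ)‖ ≤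
      (∑ x : Fin n → ↥(box 4 R), ‖w x‖) * (MP + |mc|) ^ n := by
  have hMP : 0 ≤ MP := (abs_nonneg _).trans (hP V)
  rw [Finset.sum_mul]
  refine (norm_sum_le _ _).trans (Finset.sum_le_sum fun x _ => ?_)
  rw [norm_mul]
  refine mul_le_mul_of_nonneg_left ?_ (norm_nonneg _)
  rw [norm_prod]
  calc ∏ i, ‖((r.curvature.F (configShift (-(↑(x i) : Site 4)) V) - mc : ℝ) : ℂ)‖
      ≤ ∏ _i : Fin n, (MP + |mc|) := by
        refine Finset.prod_le_prod (fun i _ => norm_nonneg _) fun i _ => ?_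
        rw [Complex.norm_real, Real.norm_eq_abs]
        exact (abs_sub _ _).trans (add_le_add (hP _) le_rfl)
    _ = (MP + |mc|) ^ n := by simp

/-- **Raw monomial pairings are bounded**: on a probability space, the integral of a product of `p + q` translated curvature
densities (read through any transformations of the lift) has modulus `≤ MP^{p+q}`. [folklore] -/
theorem klevel_raw_bound (r : LatticeRep G) (β : ℝ) (S : ℕ) {MP : ℝ} (hP : ∀ U, |r.curvature.F U| ≤ MP) {p q : ℕ}
    (f : Fin p → GaugeConfig 4 (2 * S + 1) G → LGConfig 4 G) (g : Fin q → GaugeConfig 4 (2 * S + 1) G → LGConfig 4 G) :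
    |∫ U : GaugeConfig 4 (2 * S + 1) G, (∏ i, r.curvature.F (f i U)) * ∏ i, r.curvature.F (g i U)
        ∂(wilsonMeasure r.ρ β)| ≤ MP ^ (p + q) := by
  haveI := isProbabilityMeasure_wilsonMeasure (d := 4) (L := 2 * S + 1) r.ρ r.continuous β
  have hMP : 0 ≤ MP := (abs_nonneg _).trans (hP (Classical.arbitrary _))
  have h := norm_integral_le_of_norm_le_const (μ := wilsonMeasure (d := 4) (L := 2 * S + 1) r.ρ β)
    (f := fun U : GaugeConfig 4 (2 * S + 1) G => (∏ i, r.curvature.F (f i U)) * ∏ i, r.curvature.F (g i U))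
    (C := MP ^ (p + q)) (Eventually.of_forall fun U => by
      rw [Real.norm_eq_abs, abs_mul, Finset.abs_prod, Finset.abs_prod, pow_add]
      exact mul_le_mul ((Finset.prod_le_prod (fun i _ => abs_nonneg _) fun i _ => hP _).trans (by simp))
        ((Finset.prod_le_prod (fun i _ => abs_nonneg _) fun i _ => hP _).trans (by simp))
        (Finset.prod_nonneg fun i _ => abs_nonneg _) (pow_nonneg hMP _))
  simpa [Real.norm_eq_abs] using h

omit [TopologicalSpace G] [IsTopologicalGroup G] [CompactSpace G] [MeasurableSpace G] [BorelSpace G] [Group G] in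
/-- **The far part of the coefficient sum is a lattice-weight tail.** If every finite set of site strings avoiding `(box 4 R)ⁿ` has
weight sum `≤ ε` (the shape of `stub_csclLattice`.1), then over the box-`L` strings NOT contained in `(box 4 R)ⁿ` the Schwartz
coefficients sum to `≤ 2^{8n} ‖F‖_{8n} ε`. [folklore] -/
theorem klevel_far_sum_le {n R L : ℕ} {a ε : ℝ} (F : SchwartzMap (Fin n → EuclideanSpace ℝ (Fin 4)) ℂ)
    (hR : ∀ T : Finset (Fin n → Site 4), (∀ y ∈ T, ∃ i, y i ∉ box 4 R) →
      ∑ y ∈ T, ((1 + ‖fun i => a • siteToE (y i)‖) ^ (8 * n))⁻¹ ≤ ε) :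
    (∑ x : Fin n → ↥(box 4 L), if (∀ i, (↑(x i) : Site 4) ∈ box 4 R) then (0 : ℝ)
        else ‖F (fun i => a • siteToE (↑(x i) : Site 4))‖) ≤ 2 ^ (8 * n) * schwartzNorm (8 * n) F * ε := by
  classical
  -- the far strings, as site strings
  set far : Finset (Fin n → ↥(box 4 L)) := Finset.univ.filter fun x => ¬ ∀ i, (↑(x i) : Site 4) ∈ box 4 R with hfar
  set emb : (Fin n → ↥(box 4 L)) → (Fin n → Site 4) := fun x i => (↑(x i) : Site 4) with hemb
  have hinj : Function.Injective emb := by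
    intro x y hxy
    funext i
    exact Subtype.ext (congrFun hxy i)
  have hT : ∀ y ∈ far.image emb, ∃ i, y i ∉ box 4 R := by
    intro y hy
    obtain ⟨x, hx, rfl⟩ := Finset.mem_image.1 hy
    have hx' := (Finset.mem_filter.1 hx).2
    push Not at hx'
    exact hx'
  have hK : 0 ≤ 2 ^ (8 * n) * schwartzNorm (8 * n) F := mul_nonneg (by positivity) (schwartzNorm_nonneg _ _)
  calc (∑ x : Fin n → ↥(box 4 L), if (∀ i, (↑(x i) : Site 4) ∈ box 4 R) then (0 : ℝ)
          else ‖F (fun i => a • siteToE (↑(x i) : Site 4))‖)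
      = ∑ x ∈ far, ‖F (fun i => a • siteToE (↑(x i) : Site 4))‖ := by
        rw [hfar, Finset.sum_filter]
        refine Finset.sum_congr rfl fun x _ => ?_
        by_cases h : ∀ i, (↑(x i) : Site 4) ∈ box 4 R
        · rw [if_pos h, if_neg (not_not.2 h)]
        · rw [if_neg h, if_pos h]
    _ = ∑ y ∈ far.image emb, ‖F (fun i => a • siteToE (y i))‖ := by
        rw [Finset.sum_image fun x _ y _ h => hinj h]
    _ ≤ ∑ y ∈ far.image emb, 2 ^ (8 * n) * schwartzNorm (8 * n) F * ((1 + ‖fun i => a • siteToE (y i)‖) ^ (8 * n))⁻¹ :=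
        Finset.sum_le_sum fun y _ => norm_apply_le_schwartzNorm_mul (8 * n) F _
    _ = 2 ^ (8 * n) * schwartzNorm (8 * n) F * ∑ y ∈ far.image emb, ((1 + ‖fun i => a • siteToE (y i)‖) ^ (8 * n))⁻¹ := by
        rw [Finset.mul_sum]
    _ ≤ 2 ^ (8 * n) * schwartzNorm (8 * n) F * ε := mul_le_mul_of_nonneg_left (hR _ hT) hK

/-- `√(x + y) ≤ √x + √y` for `y ≥ 0` (any real `x`). [folklore] -/
theorem klevel_sqrt_add_le {x y : ℝ} (hy : 0 ≤ y) : Real.sqrt (x + y) ≤ Real.sqrt x + Real.sqrt y := by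
  rcases le_or_gt 0 x with hx | hx
  · rw [Real.sqrt_le_left (by positivity)]
    nlinarith [Real.sq_sqrt hx, Real.sq_sqrt hy, Real.sqrt_nonneg x, Real.sqrt_nonneg y]
  · calc Real.sqrt (x + y) ≤ Real.sqrt y := Real.sqrt_le_sqrt (by linarith)
      _ ≤ Real.sqrt x + Real.sqrt y := le_add_of_nonneg_left (Real.sqrt_nonneg _)

/-- **The arithmetic endgame** of the k-level theorem: from (i) the perturbed centred pairing bound
`c ≤ ‖l‖ + δ N_F N_H + 2(η_X B_Y + B_X η_Y)`, (ii) the limit inequality `‖l‖ ≤ e √v_X √v_Y` with `0 ≤ e ≤ 1`, (iii) the variance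
comparisons `v_X ≤ P_X + κ_X`, `v_Y ≤ P_Y + κ_Y` (`κ ≥ 0`, `P ≥ 0`), conclude
`c ≤ e √P_X √P_Y + (δ N_F N_H + 2(η_X B_Y + B_X η_Y) + √κ_X √P_Y + √P_X √κ_Y + √κ_X √κ_Y)`. [folklore] -/
theorem klevel_endgame {c L e vX vY PX PY κX κY δ NF NH ηX ηY BX BY : ℝ}
    (h1 : c ≤ L + δ * NF * NH + 2 * (ηX * BY + BX * ηY)) (h2 : L ≤ e * Real.sqrt vX * Real.sqrt vY)
    (he0 : 0 ≤ e) (he1 : e ≤ 1) (hvX : vX ≤ PX + κX) (hvY : vY ≤ PY + κY) (hκX : 0 ≤ κX) (hκY : 0 ≤ κY) :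
    c ≤ e * Real.sqrt PX * Real.sqrt PY +
      (δ * NF * NH + 2 * (ηX * BY + BX * ηY) + Real.sqrt κX * Real.sqrt PY + Real.sqrt PX * Real.sqrt κY +
        Real.sqrt κX * Real.sqrt κY) := by
  have hsX : Real.sqrt vX ≤ Real.sqrt PX + Real.sqrt κX :=
    (Real.sqrt_le_sqrt hvX).trans (klevel_sqrt_add_le hκX)
  have hsY : Real.sqrt vY ≤ Real.sqrt PY + Real.sqrt κY :=
    (Real.sqrt_le_sqrt hvY).trans (klevel_sqrt_add_le hκY)
  have h3 : e * Real.sqrt vX * Real.sqrt vY ≤ e * (Real.sqrt PX + Real.sqrt κX) * (Real.sqrt PY + Real.sqrt κY) := by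
    have := mul_le_mul hsX hsY (Real.sqrt_nonneg _) (by positivity)
    calc e * Real.sqrt vX * Real.sqrt vY = e * (Real.sqrt vX * Real.sqrt vY) := by ring
      _ ≤ e * ((Real.sqrt PX + Real.sqrt κX) * (Real.sqrt PY + Real.sqrt κY)) :=
          mul_le_mul_of_nonneg_left this he0
      _ = _ := by ring
  have h4 : e * (Real.sqrt PX + Real.sqrt κX) * (Real.sqrt PY + Real.sqrt κY) ≤
      e * Real.sqrt PX * Real.sqrt PY +
        (Real.sqrt κX * Real.sqrt PY + Real.sqrt PX * Real.sqrt κY + Real.sqrt κX * Real.sqrt κY) := by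
    have hx := Real.sqrt_nonneg PX; have hy := Real.sqrt_nonneg PY
    have hkx := Real.sqrt_nonneg κX; have hky := Real.sqrt_nonneg κY
    have hrest : e * (Real.sqrt κX * Real.sqrt PY + Real.sqrt PX * Real.sqrt κY + Real.sqrt κX * Real.sqrt κY) ≤
        1 * (Real.sqrt κX * Real.sqrt PY + Real.sqrt PX * Real.sqrt κY + Real.sqrt κX * Real.sqrt κY) :=
      mul_le_mul_of_nonneg_right he1 (by positivity)
    nlinarith
  linarith

end Helpers

/-- **Registered anchor of this file** (closed form of `klevel_sqrt_add_le`, for the gate's `--supports` stub check). [folklore] -/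
theorem cscl_anchor_klevelA : ∀ (x y : ℝ), 0 ≤ y → Real.sqrt (x + y) ≤ Real.sqrt x + Real.sqrt y :=
  fun _ _ hy => klevel_sqrt_add_le hy

end Summit.QuantumFields.YangMills.Theorems.ContinuumLegGivenGap

end
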